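/- Copyright: the b2b-balaban cell (near-miss cell 7), T⁴-continuum fan-out; row NE7b ROUND-2 swarm, seat
t4-ne7b-formalise-leaf-08 (gen 4; row S1c-opt of `t4/b2b-balaban-t4-ne7b-p1/LEAVES-NE7b.md`, owner's rulings
R-OWNER-23-6 (4) and «GO leaf-08: S1c-opt» journal l.13964 — PART 1, the value-map-ABSTRACT half).  Released under the
licence of the surrounding project. -/
import Summits.QuantumFields.BalabanUV.T4Continuum.Support.HistoryRealise
import Summits.QuantumFields.BalabanUV.T4Continuum.Support.HistorySiblingEntropySortPhys

/-!
# Realised histories with DISTINCT, BOXED constituents (row S1c-opt, part 1: the displays and the abstract `Nodup`)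

Summits-side support leaf of the T⁴-continuum cell (rung (B)+1 on a FINITE torus only; NOT infinite volume, NOT the
mass gap, NOT the Clay statement; NOT a proof of the spine estimate NE7b).  Row NE7b, route «COUNT», parked∕optional row
S1c-opt (owner's ruling R-OWNER-23-6 (4), spec of record journal l.13964).  [folklore] structural recursion over the
lineage's own carrier `HistoryAdmissible.PGen` with leaf-10 gen 5's order-free birth multiset `PGen.pbirths`
(`HistorySiblingEntropySortPhys`); nothing is quoted from print, nothing printed is asserted, no `[cite:]` tag, no
`Prop`-valued FACT minted — the three `def`s below are PREDICATES WITH PARAMETERS (reading side conditions, displayed by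
whoever uses them), consumed only as binders.

WHY (finding F-leaf05g4-1, journal l.13853; ruling R-OWNER-23-6).  H3's displayed reading `HistoryRealise.Realises` lets a
component be joined with a COPY of one of its own constituents (`Realises (.join X X s) Z` is inhabited: touching allows
equal cubes, `RealisedDomains(R).disjoint` separates live COMPONENTS only), while the count of row S6g′ sees no member with
two physically identical sibling sub-histories.  The adopted remedy (R-distinct-V) DISPLAYS, per live member, the
duplicate-freeness `hdis` of its birth-VALUE multiset.  This file supplies the ORDER-FREE, NAME-FREE reading clauses from
which `hdis` follows — print's components are unions of DISTINCT (pairwise disjoint) large-field regions, and regions are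
subsets of the torus' fundamental domain (a READING of B16 pp. 384–386, not a cited fact) — and proves the abstract
multiset lemma; PART 2 (on the event that leaf-05 gen 4's value map `valP` is in the tree) instantiates it.

WHAT.
* §1 the displays: **`DisjointJoins g`** — at every join of the physical genealogy `g` the two partners' constituent
  regions are pairwise disjoint (STRUCTURAL recursion: the duplicate witness `join X X` FAILS it, because a realised region
  is inhabited and not disjoint from itself — a multiset-level «pairwise disjoint for `b ≠ b'`» would not exclude
  duplicates); **`InBoxAt n L K lv j x`** — the point `x`, at the model scale `lv j` of step `j`, lies in the period box
  of the finest torus `n·L^K` (the shape of `HistoryRealiseCells.RealisedDomains.inBox`, which boxes ROOT anchors only);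
  **`BoxedBirths n L K lv g`** — every constituent region lies in the period box at its birth level; **`RealisesD`** :=
  `Realises ∧ DisjointJoins ∧ BoxedBirths`, with `realises_of_realisesD` (so every `Realises`-consumer still applies).
* §2 `anchor_mem_region_of_realises`: along `Realises`, every constituent's anchor lies in its region (regions inhabited).
* §3 **`nodup_map_pbirths`** — THE ABSTRACT LEMMA: for ANY value map `v : PEv → (Pt d × Finset (Pt d)) → ν` that is
  FAITHFUL on the member's births (equal label and equal value ⇒ equal region), `DisjointJoins` + inhabited regions give
  `((pbirths g).map (fun bz => (bz.1, v bz.1 bz.2))).Nodup` — the letter of T3b's display `hdis` (R-OWNER-23-6 (1)).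
* §4 **`hdis_of_realisesD_of_faithful`**: the same from `RealisesD`, with faithfulness asked only on BOXED, INHABITED births
  of equal label — the hypothesis PART 2 discharges for `v := valP …` (equal level cell + equal template of boxed regions
  ⇒ equal region).
* §5 sanity (decided toys in `d = 1`): two disjoint unit regions joined satisfy `DisjointJoins`; the duplicate `join X X`
  does not.

HONEST SCOPE.  Bookkeeping over OUR carriers; `DisjointJoins`∕`BoxedBirths` are DISPLAYED reading side conditions (the
content of H3's «distinct regions inside the torus»), not discharged here; `hdis` is NOT discharged by part 1 (the value
map stays abstract); nothing of H3∕(B)∕BetaPertH touched; no landed file edited, the ENDs' `H` binder untouched; NE7b NOT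
proved.  HONEST DEPENDENCY (cell): continuum YM on T⁴ ⇐ BetaPertH ∧ nine spine estimates (0/9 proved); BetaPertH ⇐ (D1) ∧
(D4) ∧ CAP+tail; G-an2-4 gates asym, D1 and NE2/3/4.  This file changes none of it.
-/

open Finset
open Literature.MathematicalPhysics.QuantumFieldTheory.Balaban1983to89
open Literature.MathematicalPhysics.QuantumFieldTheory.Balaban1983to89.B13ScaleTransfer
open T4PersistenceDictionary
open Summit.QuantumFields.BalabanUV.T4Continuum.HistoryAdmissible
open Summit.QuantumFields.BalabanUV.T4Continuum.HistoryRealise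

namespace Summit.QuantumFields.BalabanUV.T4Continuum.HistoryRealiseDistinct

variable {d : ℕ}

/-! ## §1 The displays: disjoint partners at every join; boxed constituents; the strengthened reading -/

/-- **`DisjointJoins g`** — at every join of the physical genealogy the two partners' constituent regions are pairwise
DISJOINT (print's components are unions of distinct large-field regions).  Structural: renewals are transparent, births
carry no condition; a component joined with a copy of one of its own constituents violates it. [folklore] -/
def DisjointJoins : PGen (Pt d × Finset (Pt d)) → Prop
  | .birth _ _ _ => True
  | .renew G _ => DisjointJoins G
  | .join X Y _ => DisjointJoins X ∧ DisjointJoins Y ∧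
      ∀ b ∈ X.pbirths, ∀ b' ∈ Y.pbirths, Disjoint b.2.2 b'.2.2

/-- unfolding at a birth [folklore] -/
@[simp] theorem disjointJoins_birth (j cls : ℕ) (zZ : Pt d × Finset (Pt d)) :
    DisjointJoins (.birth j cls zZ) := trivial

/-- unfolding at a renewal [folklore] -/
@[simp] theorem disjointJoins_renew (G : PGen (Pt d × Finset (Pt d))) (h : ℕ) :
    DisjointJoins (.renew G h) ↔ DisjointJoins G := Iff.rfl

/-- unfolding at a join [folklore] -/
theorem disjointJoins_join (X Y : PGen (Pt d × Finset (Pt d))) (s : ℕ) :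
    DisjointJoins (.join X Y s) ↔ DisjointJoins X ∧ DisjointJoins Y ∧
      ∀ b ∈ X.pbirths, ∀ b' ∈ Y.pbirths, Disjoint b.2.2 b'.2.2 := Iff.rfl

/-- **`InBoxAt n L K lv j x`** — the lattice point `x` of step `j`, scaled by its level `L^{lv j}`, lies in the period box
`[0, n·L^K)^d` of the finest torus (the shape of `RealisedDomains.inBox`, at an arbitrary step). [folklore] -/
def InBoxAt (n L K : ℕ) (lv : ℕ → ℕ) (j : ℕ) (x : Pt d) : Prop :=
  ∀ i, 0 ≤ x i ∧ L ^ lv j * (x i).toNat < n * L ^ K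

/-- **`BoxedBirths n L K lv g`** — every constituent region of `g` lies in the period box at its birth level (print's
regions are subsets of the torus' fundamental domain). [folklore] -/
def BoxedBirths (n L K : ℕ) (lv : ℕ → ℕ) (g : PGen (Pt d × Finset (Pt d))) : Prop :=
  ∀ b ∈ g.pbirths, ∀ x ∈ b.2.2, InBoxAt n L K lv (PEv.step b.1) x

/-- **`RealisesD`** — the realised reading WITH DISTINCT, BOXED CONSTITUENTS: `Realises ∧ DisjointJoins ∧ BoxedBirths`
(row S1c-opt's spec of record; the order-free join clause of R-OWNER-22-18 stays parked). [folklore] -/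
def RealisesD (L : ℕ) (s : ℕ → ℕ) (R : ℕ → ℕ) (n K : ℕ) (lv : ℕ → ℕ) (g : PGen (Pt d × Finset (Pt d)))
    (Z : Finset (Pt d)) : Prop :=
  Realises L s R g Z ∧ DisjointJoins g ∧ BoxedBirths n L K lv g

section Reading

variable {L : ℕ} {s R : ℕ → ℕ} {n K : ℕ} {lv : ℕ → ℕ} {g : PGen (Pt d × Finset (Pt d))} {Z : Finset (Pt d)}

/-- the strengthened reading implies the landed one (every `Realises`-consumer applies) [folklore] -/
theorem realises_of_realisesD (h : RealisesD L s R n K lv g Z) : Realises L s R g Z := h.1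

/-- … and carries the disjoint-partners display [folklore] -/
theorem disjointJoins_of_realisesD (h : RealisesD L s R n K lv g Z) : DisjointJoins g := h.2.1

/-- … and the boxed-constituents display [folklore] -/
theorem boxedBirths_of_realisesD (h : RealisesD L s R n K lv g Z) : BoxedBirths n L K lv g := h.2.2

end Reading

/-! ## §2 Along `Realises`, every constituent region is inhabited by its anchor -/

/-- **REGIONS OF REALISED BIRTHS ARE INHABITED**: every physical birth `(label, (anchor, region))` of a realised history
has `anchor ∈ region` (the birth clause of `Realises`; renewals and joins recurse). [folklore] -/
theorem anchor_mem_region_of_realises {L : ℕ} {s R : ℕ → ℕ} :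
    ∀ (g : PGen (Pt d × Finset (Pt d))) (Z : Finset (Pt d)), Realises L s R g Z →
      ∀ b ∈ g.pbirths, b.2.1 ∈ b.2.2
  | .birth j cls zZ, Z, h => by
      intro b hb
      rw [PGen.pbirths_birth, Multiset.mem_singleton] at hb
      subst hb
      obtain ⟨hZ, hz, -⟩ := h
      show zZ.1 ∈ zZ.2
      rw [hZ]
      exact hz
  | .renew G hh, Z, h => by
      obtain ⟨ZG, hG, -⟩ := h
      intro b hb
      rw [PGen.pbirths_renew] at hb
      exact anchor_mem_region_of_realises G ZG hG b hb
  | .join X Y sj, Z, h => by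
      obtain ⟨ZX, ZY, hX, hY, -⟩ := h
      intro b hb
      rw [PGen.pbirths_join, Multiset.mem_add] at hb
      rcases hb with hb | hb
      · exact anchor_mem_region_of_realises X ZX hX b hb
      · exact anchor_mem_region_of_realises Y ZY hY b hb

/-! ## §3 The abstract duplicate-freeness of the birth-value multiset -/

/-- **THE ABSTRACT LEMMA.**  For ANY value map `v` on (label, payload) that is FAITHFUL on the member's births — equal label
and equal value force equal REGION — the displays `DisjointJoins g` and «every region is inhabited by its anchor» give
duplicate-freeness of the birth-value multiset `(pbirths g).map (label, v label payload)` (T3b's `hdis` letter,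
R-OWNER-23-6 (1)).  Join case: `Multiset.nodup_add`; a common value of an `X`-birth and a `Y`-birth would force equal,
hence (being disjoint and inhabited) impossible, regions. [folklore] -/
theorem nodup_map_pbirths {ν : Type*} (v : PEv → Pt d × Finset (Pt d) → ν) :
    ∀ g : PGen (Pt d × Finset (Pt d)), DisjointJoins g → (∀ b ∈ g.pbirths, b.2.1 ∈ b.2.2) →
      (∀ b ∈ g.pbirths, ∀ b' ∈ g.pbirths, b.1 = b'.1 → v b.1 b.2 = v b'.1 b'.2 → b.2.2 = b'.2.2) →
      (g.pbirths.map (fun bz => (bz.1, v bz.1 bz.2))).Nodup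
  | .birth j cls zZ, _, _, _ => by
      rw [PGen.pbirths_birth, Multiset.map_singleton]
      exact Multiset.nodup_singleton _
  | .renew G hh, hd, hne, hinj => by
      rw [PGen.pbirths_renew] at hne hinj ⊢
      exact nodup_map_pbirths v G hd hne hinj
  | .join X Y sj, hd, hne, hinj => by
      obtain ⟨hdX, hdY, hXY⟩ := hd
      rw [PGen.pbirths_join] at hne hinj ⊢
      rw [Multiset.map_add, Multiset.nodup_add]
      refine ⟨nodup_map_pbirths v X hdX (fun b hb => hne b (Multiset.mem_add.2 (Or.inl hb)))
          (fun b hb b' hb' => hinj b (Multiset.mem_add.2 (Or.inl hb)) b' (Multiset.mem_add.2 (Or.inl hb'))),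
        nodup_map_pbirths v Y hdY (fun b hb => hne b (Multiset.mem_add.2 (Or.inr hb)))
          (fun b hb b' hb' => hinj b (Multiset.mem_add.2 (Or.inr hb)) b' (Multiset.mem_add.2 (Or.inr hb'))), ?_⟩
      refine Multiset.disjoint_left.2 ?_
      intro w hwX hwY
      obtain ⟨b, hb, rfl⟩ := Multiset.mem_map.1 hwX
      obtain ⟨b', hb', hbb'⟩ := Multiset.mem_map.1 hwY
      obtain ⟨h1, h2⟩ := Prod.mk.inj hbb'
      have hreg : b.2.2 = b'.2.2 :=
        hinj b (Multiset.mem_add.2 (Or.inl hb)) b' (Multiset.mem_add.2 (Or.inr hb')) h1.symm h2.symm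
      have hdis : Disjoint b.2.2 b'.2.2 := hXY b hb b' hb'
      have hmem : b.2.1 ∈ b.2.2 := hne b (Multiset.mem_add.2 (Or.inl hb))
      rw [hreg] at hdis hmem
      exact Finset.disjoint_left.1 hdis hmem hmem

/-! ## §4 From the strengthened reading, for a value map faithful on boxed inhabited births -/

section Faithful

variable {L : ℕ} {s R : ℕ → ℕ} {n K : ℕ} {lv : ℕ → ℕ} {g : PGen (Pt d × Finset (Pt d))} {Z : Finset (Pt d)}

/-- **`hdis` FROM `RealisesD`, FOR A VALUE MAP FAITHFUL ON BOXED, INHABITED BIRTHS OF EQUAL LABEL** (the shape PART 2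
discharges for leaf-05 gen 4's `valP`: equal level cell and equal template of two BOXED regions with anchors inside ⇒
equal region). [folklore] -/
theorem hdis_of_realisesD_of_faithful {ν : Type*} (v : PEv → Pt d × Finset (Pt d) → ν)
    (hv : ∀ b ∈ g.pbirths, ∀ b' ∈ g.pbirths, b.1 = b'.1 →
      (∀ x ∈ b.2.2, InBoxAt n L K lv (PEv.step b.1) x) → (∀ x ∈ b'.2.2, InBoxAt n L K lv (PEv.step b'.1) x) →
      b.2.1 ∈ b.2.2 → b'.2.1 ∈ b'.2.2 → v b.1 b.2 = v b'.1 b'.2 → b.2.2 = b'.2.2)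
    (h : RealisesD L s R n K lv g Z) :
    (g.pbirths.map (fun bz => (bz.1, v bz.1 bz.2))).Nodup :=
  nodup_map_pbirths v g h.2.1 (anchor_mem_region_of_realises g Z h.1)
    (fun b hb b' hb' hl hvv => hv b hb b' hb' hl (h.2.2 b hb) (h.2.2 b' hb')
      (anchor_mem_region_of_realises g Z h.1 b hb) (anchor_mem_region_of_realises g Z h.1 b' hb') hvv)

/-- **THE DISPLAY-TO-DISPLAY FORM** (no `Realises` needed): `DisjointJoins` + `BoxedBirths` + inhabited regions + a value
map faithful on boxed inhabited births of equal label ⇒ `hdis`. [folklore] -/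
theorem hdis_of_displays {ν : Type*} (v : PEv → Pt d × Finset (Pt d) → ν)
    (hd : DisjointJoins g) (hB : BoxedBirths n L K lv g) (hne : ∀ b ∈ g.pbirths, b.2.1 ∈ b.2.2)
    (hv : ∀ b ∈ g.pbirths, ∀ b' ∈ g.pbirths, b.1 = b'.1 →
      (∀ x ∈ b.2.2, InBoxAt n L K lv (PEv.step b.1) x) → (∀ x ∈ b'.2.2, InBoxAt n L K lv (PEv.step b'.1) x) →
      b.2.1 ∈ b.2.2 → b'.2.1 ∈ b'.2.2 → v b.1 b.2 = v b'.1 b'.2 → b.2.2 = b'.2.2) :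
    (g.pbirths.map (fun bz => (bz.1, v bz.1 bz.2))).Nodup :=
  nodup_map_pbirths v g hd hne
    (fun b hb b' hb' hl hvv => hv b hb b' hb' hl (hB b hb) (hB b' hb') (hne b hb) (hne b' hb') hvv)

end Faithful

/-! ## §5 Sanity (decided toys, `d = 1`) -/

namespace Sanity

/-- a unit region at the point `k` of the line -/
def reg (k : ℤ) : Pt 1 × Finset (Pt 1) := (fun _ => k, {fun _ => k})

/-- two DISJOINT unit regions joined at step `1`: the display holds -/
example : DisjointJoins (.join (.birth 0 0 (reg 0)) (.birth 0 0 (reg 1)) 1) := by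
  refine ⟨trivial, trivial, ?_⟩
  intro b hb b' hb'
  rw [PGen.pbirths_birth, Multiset.mem_singleton] at hb hb'
  subst hb; subst hb'
  rw [Finset.disjoint_left]
  intro x hx hx'
  simp only [reg, Finset.mem_singleton] at hx hx'
  have h := congrFun (hx.symm.trans hx') 0
  simp at h

/-- THE DUPLICATE WITNESS of F-leaf05g4-1 — a constituent joined with a copy of itself — FAILS the display -/
example : ¬ DisjointJoins (.join (.birth 0 0 (reg 0)) (.birth 0 0 (reg 0)) 1) := by
  rintro ⟨-, -, h⟩
  have hb : ((((0 : ℕ), (0 : Fin 3), (0 : ℕ)) : PEv), reg 0) ∈ (PGen.birth 0 0 (reg 0)).pbirths := by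
    rw [PGen.pbirths_birth, Multiset.mem_singleton]
  have hdis := h _ hb _ hb
  rw [Finset.disjoint_left] at hdis
  have hx : (fun _ => (0 : ℤ) : Pt 1) ∈ (reg 0).2 := by simp [reg]
  exact hdis hx hx

/-- the abstract lemma on the two-region toy with the IDENTITY value map (faithful trivially): the value multiset is
duplicate-free -/
example : (((PGen.join (.birth 0 0 (reg 0)) (.birth 0 0 (reg 1)) 1).pbirths).map
    (fun bz => (bz.1, (fun (_ : PEv) (p : Pt 1 × Finset (Pt 1)) => p) bz.1 bz.2))).Nodup := by
  refine nodup_map_pbirths (fun (_ : PEv) (p : Pt 1 × Finset (Pt 1)) => p)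
    (PGen.join (.birth 0 0 (reg 0)) (.birth 0 0 (reg 1)) 1) ⟨trivial, trivial, ?_⟩ ?_ ?_
  · intro b hb b' hb'
    rw [PGen.pbirths_birth, Multiset.mem_singleton] at hb hb'
    subst hb; subst hb'
    rw [Finset.disjoint_left]
    intro x hx hx'
    simp only [reg, Finset.mem_singleton] at hx hx'
    have h := congrFun (hx.symm.trans hx') 0
    simp at h
  · intro b hb
    rw [PGen.pbirths_join, Multiset.mem_add, PGen.pbirths_birth, PGen.pbirths_birth, Multiset.mem_singleton,
      Multiset.mem_singleton] at hb
    rcases hb with rfl | rfl <;> simp [reg]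
  · intro b _ b' _ _ hv
    exact congrArg Prod.snd hv

end Sanity

end Summit.QuantumFields.BalabanUV.T4Continuum.HistoryRealiseDistinct
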